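import Mathlib
import Summits.Ventures.PercRepro2.PointSplitBHK

/-!
# The point-split forms when the split point is avoided: (PS) and (PS1) reduce to BHK
(blind cell PercRepro2, night-3 g23, 2026-08-28; `proofs/NIGHT3-CERT.md` §32.3)

If the split point `v` lies in one of the avoided sets, say `v ∈ X`, then on `{s ↮ X}` the weight
`1_{v ∈ C_s}` vanishes and `1_{v ∉ C_s}` is `1`, so both point-split forms collapse to the single
BHK instance `E[F·1_X]·E[G·1_{v ∈ ·}·1_Y] ≤ E[F·(G·1_{v ∈ ·})·1_{X∩Y}]·P(X ∪ Y)`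
(`bhk_induced` with the functionals `F` and `G·1_{v ∈ ·}`):

* `mixedForm_split_nonneg_of_mem_left` / `_right`: `M(1_{vH}, 1_{v̄H}) ≥ 0` when `v ∈ X` or `v ∈ Y`;
* `mixedForm_one_nonneg_of_mem_left` / `_right`: `M(1_{vH}, 1) ≥ 0` likewise.

So the candidates (PS) / (PS1) of `PointSplitBHK.lean` have new content only for `v ∉ X ∪ Y` — in
the (3M) application, for `v ≠ a₁`.  Own work; standard axioms.
-/

namespace Summit.Ventures.PercRepro2

open UnionCluster

namespace CovForm

namespace PointSplit

variable {V : Type*} {E : Type*} [Fintype E] [DecidableEq E]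
  {R : Type*} [Field R] [LinearOrder R] [IsStrictOrderedRing R]

omit [LinearOrder R] [IsStrictOrderedRing R] in
/-- With `v ∈ X`, the weight `1_{v ∈ C_s}` vanishes on `{s ↮ X}`. -/
lemma wExpect_indicator_vanish (p : E → R) (ends : E → Sym2 V) (s v : V) {X : Finset V}
    (hv : v ∈ X) (F : Set V → R) :
    wExpect p ends s X F ((connEvent ends s v).indicator 1) = 0 := by
  unfold wExpect
  have : (fun ω => F (cluster ends ω s) * (connEvent ends s v).indicator 1 ω *
      (avoidAll ends s X).indicator 1 ω) = fun _ => 0 := by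
    funext ω
    by_cases hX : ω ∈ avoidAll ends s X
    · have hc : ω ∉ connEvent ends s v := fun h => hX v hv h
      rw [Set.indicator_of_notMem hc]
      simp
    · rw [Set.indicator_of_notMem hX]
      simp
  rw [this]
  simp [expect]

omit [LinearOrder R] [IsStrictOrderedRing R] in
/-- With `v ∈ X`, the weight `1_{v ∉ C_s}` is `1` on `{s ↮ X}`. -/
lemma wExpect_indicator_compl_of_mem (p : E → R) (ends : E → Sym2 V) (s v : V) {X : Finset V}
    (hv : v ∈ X) (F : Set V → R) :
    wExpect p ends s X F (((connEvent ends s v)ᶜ).indicator 1) =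
      wExpect p ends s X F (fun _ => 1) := by
  unfold wExpect
  refine congrArg _ (funext fun ω => ?_)
  by_cases hX : ω ∈ avoidAll ends s X
  · have hc : ω ∈ (connEvent ends s v)ᶜ := fun h => hX v hv h
    rw [Set.indicator_of_mem hc]
    rfl
  · rw [Set.indicator_of_notMem hX]
    simp

omit [LinearOrder R] [IsStrictOrderedRing R] in
/-- The weight `1_{vH}` as the functional `F · 1_{v ∈ ·}`. -/
lemma wExpect_indicator_conn_eq (p : E → R) (ends : E → Sym2 V) (s v : V) (X : Finset V)
    (F : Set V → R) :
    wExpect p ends s X F ((connEvent ends s v).indicator 1) =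
      wExpect p ends s X (fun W => F W * {W : Set V | v ∈ W}.indicator 1 W) (fun _ => 1) := by
  unfold wExpect
  refine congrArg _ (funext fun ω => ?_)
  have e : (connEvent ends s v).indicator (1 : Config E → R) ω =
      {W : Set V | v ∈ W}.indicator (1 : Set V → R) (cluster ends ω s) := by
    by_cases h : ω ∈ connEvent ends s v
    · rw [Set.indicator_of_mem h,
        Set.indicator_of_mem (show cluster ends ω s ∈ {W : Set V | v ∈ W} from h)]
      rfl
    · rw [Set.indicator_of_notMem h,
        Set.indicator_of_notMem (show cluster ends ω s ∉ {W : Set V | v ∈ W} from h)]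
  rw [e]
  ring

/-- `G · 1_{v ∈ ·}` is monotone for monotone nonnegative `G`. -/
lemma monotone_mul_indicator_mem {G : Set V → R} (hG : Monotone G) (hG0 : ∀ S, 0 ≤ G S)
    (v : V) : Monotone (fun W : Set V => G W * {W : Set V | v ∈ W}.indicator 1 W) := by
  intro W W' h
  simp only
  by_cases hW : v ∈ W
  · rw [Set.indicator_of_mem (show W ∈ {W : Set V | v ∈ W} from hW),
      Set.indicator_of_mem (show W' ∈ {W : Set V | v ∈ W} from h hW)]
    simpa using hG h
  · rw [Set.indicator_of_notMem (show W ∉ {W : Set V | v ∈ W} from hW)]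
    simp only [mul_zero]
    exact mul_nonneg (hG0 W') (Set.indicator_apply_nonneg fun _ => zero_le_one)

omit [Fintype E] [DecidableEq E] in
/-- `G · 1_{v ∈ ·}` is nonnegative for nonnegative `G`. -/
lemma nonneg_mul_indicator_mem {G : Set V → R} (hG0 : ∀ S, 0 ≤ G S) (v : V) (S : Set V) :
    0 ≤ (fun W : Set V => G W * {W : Set V | v ∈ W}.indicator 1 W) S :=
  mul_nonneg (hG0 S) (Set.indicator_apply_nonneg fun _ => zero_le_one)

omit [LinearOrder R] [IsStrictOrderedRing R] in
/-- Swapping the two sides of the polarised form. -/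
lemma mixedFormW_swap [DecidableEq V] (p : E → R) (ends : E → Sym2 V) (s : V) (X Y : Finset V)
    (F G : Set V → R) (w₁ w₂ : Config E → R) :
    mixedFormW p ends s X Y F G w₁ w₂ = mixedFormW p ends s Y X G F w₁ w₂ := by
  unfold mixedFormW
  have e : (fun W => F W * G W) = fun W => G W * F W := by funext W; ring
  rw [Finset.inter_comm, Finset.union_comm, e]
  ring

/-- **(PS) is BHK when the split point is avoided on the left**: `v ∈ X ⟹ M(1_{vH}, 1_{v̄H}) ≥ 0`. -/
theorem mixedForm_split_nonneg_of_mem_left [Fintype V] [DecidableEq V] (p : E → R)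
    (hp : IsProbVec p) (ends : E → Sym2 V) (s v : V) {X Y : Finset V} (hv : v ∈ X)
    {F G : Set V → R} (hF : Monotone F) (hG : Monotone G) (hF0 : ∀ S, 0 ≤ F S)
    (hG0 : ∀ S, 0 ≤ G S) :
    0 ≤ mixedFormW p ends s X Y F G ((connEvent ends s v).indicator 1)
      (((connEvent ends s v)ᶜ).indicator 1) := by
  have hvU : v ∈ X ∪ Y := Finset.mem_union_left Y hv
  have key := bhkForm_one_nonneg p hp ends s X Y hF (monotone_mul_indicator_mem hG hG0 v) hF0
    (nonneg_mul_indicator_mem hG0 v)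
  unfold bhkFormW at key
  unfold mixedFormW
  rw [wExpect_indicator_vanish p ends s v hv, wExpect_indicator_vanish p ends s v hvU,
    wExpect_indicator_compl_of_mem p ends s v hv, wExpect_indicator_compl_of_mem p ends s v hvU,
    wExpect_indicator_conn_eq, wExpect_indicator_conn_eq]
  have e : (fun W => F W * G W * {W : Set V | v ∈ W}.indicator 1 W) =
      fun W => F W * (fun W => G W * {W : Set V | v ∈ W}.indicator 1 W) W := by
    funext W; ring
  rw [e]
  linarith [key]

/-- **(PS) is BHK when the split point is avoided on the right**: `v ∈ Y ⟹ M(1_{vH}, 1_{v̄H}) ≥ 0`. -/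
theorem mixedForm_split_nonneg_of_mem_right [Fintype V] [DecidableEq V] (p : E → R)
    (hp : IsProbVec p) (ends : E → Sym2 V) (s v : V) {X Y : Finset V} (hv : v ∈ Y)
    {F G : Set V → R} (hF : Monotone F) (hG : Monotone G) (hF0 : ∀ S, 0 ≤ F S)
    (hG0 : ∀ S, 0 ≤ G S) :
    0 ≤ mixedFormW p ends s X Y F G ((connEvent ends s v).indicator 1)
      (((connEvent ends s v)ᶜ).indicator 1) := by
  rw [mixedFormW_swap]
  exact mixedForm_split_nonneg_of_mem_left p hp ends s v hv hG hF hG0 hF0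

/-- **(PS1) is BHK when the split point is avoided on the left**: `v ∈ X ⟹ M(1_{vH}, 1) ≥ 0`. -/
theorem mixedForm_one_nonneg_of_mem_left [Fintype V] [DecidableEq V] (p : E → R)
    (hp : IsProbVec p) (ends : E → Sym2 V) (s v : V) {X Y : Finset V} (hv : v ∈ X)
    {F G : Set V → R} (hF : Monotone F) (hG : Monotone G) (hF0 : ∀ S, 0 ≤ F S)
    (hG0 : ∀ S, 0 ≤ G S) :
    0 ≤ mixedFormW p ends s X Y F G ((connEvent ends s v).indicator 1) (fun _ => 1) := by
  have hvU : v ∈ X ∪ Y := Finset.mem_union_left Y hv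
  have key := bhkForm_one_nonneg p hp ends s X Y hF (monotone_mul_indicator_mem hG hG0 v) hF0
    (nonneg_mul_indicator_mem hG0 v)
  unfold bhkFormW at key
  unfold mixedFormW
  rw [wExpect_indicator_vanish p ends s v hv, wExpect_indicator_vanish p ends s v hvU,
    wExpect_indicator_conn_eq, wExpect_indicator_conn_eq]
  have e : (fun W => F W * G W * {W : Set V | v ∈ W}.indicator 1 W) =
      fun W => F W * (fun W => G W * {W : Set V | v ∈ W}.indicator 1 W) W := by
    funext W; ring
  rw [e]
  linarith [key]

/-- **(PS1) is BHK when the split point is avoided on the right**: `v ∈ Y ⟹ M(1_{vH}, 1) ≥ 0`. -/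
theorem mixedForm_one_nonneg_of_mem_right [Fintype V] [DecidableEq V] (p : E → R)
    (hp : IsProbVec p) (ends : E → Sym2 V) (s v : V) {X Y : Finset V} (hv : v ∈ Y)
    {F G : Set V → R} (hF : Monotone F) (hG : Monotone G) (hF0 : ∀ S, 0 ≤ F S)
    (hG0 : ∀ S, 0 ≤ G S) :
    0 ≤ mixedFormW p ends s X Y F G ((connEvent ends s v).indicator 1) (fun _ => 1) := by
  rw [mixedFormW_swap]
  exact mixedForm_one_nonneg_of_mem_left p hp ends s v hv hG hF hG0 hF0

end PointSplit

end CovForm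

end Summit.Ventures.PercRepro2
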